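import Summits.HubbardSuperconductivity.HubbardSuperconductivity.Theorems.AnisotropyChordTransferFeynmanBijl
import Summits.HubbardSuperconductivity.HubbardSuperconductivity.Theorems.AnisotropyChordStiffnessFerroPointStiffness
import Summits.HubbardSuperconductivity.HubbardSuperconductivity.Theorems.AnisotropyChordTransferBEC

/-!
# Route `AnisotropyChord` / H0 rotor rung, route (1): THE DOMAIN EDGE `Δ = 1` OF THE FULL-GAP ROUTE — at the ferromagnetic point
# no `c/L` sector gap survives (theory seat `hubbard-h0-rotor-theory-1` g12, cell INBOX l.481/l.483 item (2b)/(β); prover seat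
# `hubbard-h0-rotor-p1` g15)

At `Δ = 1` the Perron sector amplitude is UNIFORM on its sector (tree `Stiffness.Doob.perronAmplitude_at_one_uniform`), so its structure
factor is an exchangeability moment:

* `sum_siteCos_sq` — `Σ_s cos²(2πs₀/L) = L²/2` (`L ≥ 3`); `card_one_one` — `#{σ ∈ S_m : σ_s = σ_t = 1} = B − A(s,t)`;
* **`strucC_at_one`** — `strucC a = ((L²/2)² − M²)/(2(L² − 1))` for the Perron amplitude of sector `M` of `H(1)` (`= |V|·S(k₁)`,
  `S(k₁) → ρ(1−ρ)/2`: the uniform state is NOT hyperuniform);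
* **`sectorGap_at_one_le`** — with FEYNMAN–BIJL (`gap_le_feynmanBijl`) and `fsumC ≤ 2π²`: every Temple-form sector gap at `Δ = 1`
  obeys `g ≤ 8π²(L² − 1)/((L²/2)² − M²) = O(1/L²)`;
* **`not_sectorGapAtLeast_at_one`** — hence for every `c > 0` and `k`, for all large EVEN `L` and all sectors `0 ≤ j ≤ k`:
  `¬ SectorGapAtLeast L 1 j (c/L)` — the full-gap (R-route) form of (H2) provably fails at the isotropic point, where PROPOSITION N's
  f-sum constant `(1−Δ)/4` vanishes too (`fsumLower_eventually`).  (Odd `L`: integer sectors are empty and the Prop is vacuous.)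

All folklore (SU(2) degeneracy of the ferromagnet; Feynman–Bijl).
-/

set_option linter.dupNamespace false
set_option autoImplicit false

noncomputable section

open Finset Filter Topology
open Literature.MathematicalPhysics.QuantumLattice Literature.Probability.LatticeModels
open Summit.HubbardSuperconductivity.HubbardSuperconductivity.Theorems.AnisotropyChord.InsertionEntropy
open Summit.HubbardSuperconductivity.HubbardSuperconductivity.Theorems.AnisotropyChord.Tower

namespace Summit.HubbardSuperconductivity.HubbardSuperconductivity.Theorems.AnisotropyChord.Transfer

variable {L : ℕ} [NeZero L]

/-! ## Trigonometric and exchangeability moments -/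

/-- `Σ_s cos²(2πs₀/L) = L²/2` on `(ℤ/L)²`, `L ≥ 3` (`cos² = (1 + Re χ_{2e₀})/2`, `Σ_x χ_{2e₀}(x) = 0`). [folklore] -/
theorem sum_siteCos_sq (hL : 3 ≤ L) : ∑ s : TorusSite 2 L, siteCos L s ^ 2 = (L : ℝ) ^ 2 / 2 := by
  have hL2 : 2 ≤ L := le_trans (by norm_num) hL
  set e₀ : TorusSite 2 L := Pi.single 0 1 with he
  have re_sq : ∀ w : ℂ, w.re ^ 2 = (Complex.normSq w + (w ^ 2).re) / 2 := fun w => by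
    rw [Complex.normSq_apply, pow_two w, Complex.mul_re]; ring
  have hsum2 : ∑ x : TorusSite 2 L, torusChar e₀ x ^ 2 = 0 := by
    have h2 : ∀ x : TorusSite 2 L, torusChar e₀ x ^ 2 = torusChar (e₀ + e₀) x := fun x => by
      rw [pow_two, torusChar_comm (e₀ + e₀), torusChar_add_right, torusChar_comm x e₀]
    simp only [h2]
    rw [sum_torusChar_right, if_neg (single_add_single_ne_zero hL)]
  calc ∑ s : TorusSite 2 L, siteCos L s ^ 2
      = ∑ s : TorusSite 2 L, (1 + (torusChar e₀ s ^ 2).re) / 2 := by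
        refine Finset.sum_congr rfl fun s _ => ?_
        rw [siteCos_eq_re hL2, re_sq, normSq_torusChar]
    _ = ((Fintype.card (TorusSite 2 L) : ℝ) + (∑ s : TorusSite 2 L, torusChar e₀ s ^ 2).re) / 2 := by
        rw [← Finset.sum_div, Finset.sum_add_distrib, Finset.sum_const, Finset.card_univ, nsmul_eq_mul, mul_one,
          Complex.re_sum]
    _ = (L : ℝ) ^ 2 / 2 := by
        have hcardT : Fintype.card (TorusSite 2 L) = L ^ 2 := by rw [Fintype.card_fun, ZMod.card, Fintype.card_fin]
        rw [hsum2, Complex.zero_re, add_zero, hcardT]; push_cast; ring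

/-- two-site occupation count in a sector: `#{σ ∈ S_m : σ_s = 1 ∧ σ_t = 1} = B_m(s) − A_m(s,t)` (split `{σ_s = 1}` by `σ_t`). [folklore] -/
theorem card_one_one (m : ℕ) (s t : TorusSite 2 L) :
    ((((Stiffness.Exch.sector (TorusSite 2 L) m).filter fun σ => σ s = 1 ∧ σ t = 1).card : ℕ) : ℝ)
      = (Stiffness.Exch.B m s : ℝ) - (Stiffness.Exch.A m s t : ℝ) := by
  have hsplit : ((Stiffness.Exch.sector (TorusSite 2 L) m).filter fun σ => σ s = 1)
      = ((Stiffness.Exch.sector (TorusSite 2 L) m).filter fun σ => σ s = 1 ∧ σ t = 1)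
        ∪ ((Stiffness.Exch.sector (TorusSite 2 L) m).filter fun σ => σ s = 1 ∧ σ t = 0) := by
    ext σ
    simp only [Finset.mem_filter, Finset.mem_union]
    rcases Stiffness.Doob.fin2_eq_zero_or_one (σ t) with h | h <;> simp [h]
  have hdisj : Disjoint ((Stiffness.Exch.sector (TorusSite 2 L) m).filter fun σ => σ s = 1 ∧ σ t = 1)
      ((Stiffness.Exch.sector (TorusSite 2 L) m).filter fun σ => σ s = 1 ∧ σ t = 0) := by
    rw [Finset.disjoint_filter]
    intro σ _ h1 h2
    rw [h1.2] at h2; exact absurd h2.2 (by decide)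
  have hB : Stiffness.Exch.B m s
      = ((Stiffness.Exch.sector (TorusSite 2 L) m).filter fun σ => σ s = 1 ∧ σ t = 1).card + Stiffness.Exch.A m s t := by
    unfold Stiffness.Exch.B Stiffness.Exch.A
    rw [hsplit, Finset.card_union_of_disjoint hdisj]
  have := congrArg (fun n : ℕ => (n : ℝ)) hB
  push_cast at this
  linarith

/-- `A_m(s, s) = 0`. [folklore] -/
theorem exchA_self (m : ℕ) (s : TorusSite 2 L) : Stiffness.Exch.A m s s = 0 := by
  unfold Stiffness.Exch.A
  rw [Finset.card_eq_zero, Finset.filter_eq_empty_iff]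
  intro σ _ h
  rw [h.1] at h; exact absurd h.2 (by decide)

/-- **second moment of the density wave in a sector:** `Σ_{σ ∈ S_m} c(σ)² = A_m(0, e₀) · Σ_s c_s²` (`L ≥ 2`; exchangeability and
`Σ_s c_s = 0`). [folklore] -/
theorem sum_sector_cosWave_sq (hL : 2 ≤ L) (m : ℕ) :
    ∑ σ ∈ Stiffness.Exch.sector (TorusSite 2 L) m, cosWave L σ ^ 2
      = (Stiffness.Exch.A m (0 : TorusSite 2 L) (0 + Pi.single 0 1) : ℝ) * ∑ s : TorusSite 2 L, siteCos L s ^ 2 := by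
  set S := Stiffness.Exch.sector (TorusSite 2 L) m with hS
  set A₀ : ℝ := (Stiffness.Exch.A m (0 : TorusSite 2 L) (0 + Pi.single 0 1) : ℝ) with hA₀
  set B₀ : ℝ := (Stiffness.Exch.B m (0 : TorusSite 2 L) : ℝ) with hB₀
  have hne0 : (0 : TorusSite 2 L) ≠ 0 + Pi.single 0 1 := (Stiffness.add_single_ne_self hL 0 0).symm
  -- the two-site counts
  have hN : ∀ s t : TorusSite 2 L, (∑ σ ∈ S, occNum L σ s * occNum L σ t)
      = B₀ - (if s = t then 0 else A₀) := by
    intro s t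
    have hcount : (∑ σ ∈ S, occNum L σ s * occNum L σ t)
        = (((S.filter fun σ => σ s = 1 ∧ σ t = 1).card : ℕ) : ℝ) := by
      rw [Finset.card_filter]; push_cast
      refine Finset.sum_congr rfl fun σ _ => ?_
      unfold occNum
      rcases Stiffness.Doob.fin2_eq_zero_or_one (σ s) with h1 | h1 <;>
        rcases Stiffness.Doob.fin2_eq_zero_or_one (σ t) with h2 | h2 <;> simp [h1, h2]
    rw [hcount, hS, card_one_one, Stiffness.Exch.B_const m s 0, ← hB₀]
    by_cases hst : s = t
    · subst hst; rw [exchA_self, if_pos rfl]; simp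
    · rw [if_neg hst, hA₀, Stiffness.Exch.A_const m hst hne0]
  have hc0 : ∑ s : TorusSite 2 L, siteCos L s = 0 := sum_cosSite_eq_zero hL
  calc ∑ σ ∈ S, cosWave L σ ^ 2
      = ∑ σ ∈ S, ∑ s, ∑ t, siteCos L s * siteCos L t * (occNum L σ s * occNum L σ t) := by
        refine Finset.sum_congr rfl fun σ _ => ?_
        rw [cosWave_eq, pow_two, Finset.sum_mul_sum]
        refine Finset.sum_congr rfl fun s _ => Finset.sum_congr rfl fun t _ => by ring
    _ = ∑ s, ∑ t, siteCos L s * siteCos L t * ∑ σ ∈ S, occNum L σ s * occNum L σ t := by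
        rw [Finset.sum_comm]
        refine Finset.sum_congr rfl fun s _ => ?_
        rw [Finset.sum_comm]
        refine Finset.sum_congr rfl fun t _ => ?_
        rw [Finset.mul_sum]
    _ = ∑ s, ∑ t, (siteCos L s * siteCos L t * B₀ - siteCos L s * siteCos L t * (if s = t then 0 else A₀)) := by
        refine Finset.sum_congr rfl fun s _ => Finset.sum_congr rfl fun t _ => ?_
        rw [hN s t]; ring
    _ = (∑ s : TorusSite 2 L, ∑ t, siteCos L s * siteCos L t * B₀)
          - ∑ s : TorusSite 2 L, ∑ t, siteCos L s * siteCos L t * (if s = t then 0 else A₀) := by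
        rw [← Finset.sum_sub_distrib]
        exact Finset.sum_congr rfl fun s _ => by rw [Finset.sum_sub_distrib]
    _ = A₀ * ∑ s : TorusSite 2 L, siteCos L s ^ 2 := by
        have hB : ∑ s : TorusSite 2 L, ∑ t, siteCos L s * siteCos L t * B₀ = 0 := by
          have e : ∑ s : TorusSite 2 L, ∑ t : TorusSite 2 L, siteCos L s * siteCos L t * B₀
              = ((∑ s : TorusSite 2 L, siteCos L s) * (∑ t : TorusSite 2 L, siteCos L t)) * B₀ := by
            rw [Finset.sum_mul_sum, Finset.sum_mul]
            exact Finset.sum_congr rfl fun s _ => by rw [Finset.sum_mul]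
          rw [e, hc0]; ring
        have hinner : ∀ s : TorusSite 2 L, ∑ t, siteCos L s * siteCos L t * (if s = t then 0 else A₀)
            = A₀ * (siteCos L s * ∑ t, siteCos L t) - A₀ * siteCos L s ^ 2 := by
          intro s
          have e : ∀ t, siteCos L s * siteCos L t * (if s = t then 0 else A₀)
              = A₀ * (siteCos L s * siteCos L t) - (if s = t then A₀ * (siteCos L s * siteCos L t) else 0) := by
            intro t; split_ifs <;> ring
          simp only [e]
          rw [Finset.sum_sub_distrib, ← Finset.mul_sum, ← Finset.mul_sum, Finset.sum_ite_eq Finset.univ s,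
            if_pos (Finset.mem_univ s)]
          ring
        have hA : ∑ s : TorusSite 2 L, ∑ t, siteCos L s * siteCos L t * (if s = t then 0 else A₀)
            = -(A₀ * ∑ s : TorusSite 2 L, siteCos L s ^ 2) := by
          simp only [hinner, hc0, mul_zero, zero_sub]
          rw [Finset.sum_neg_distrib, ← Finset.mul_sum]
        rw [hB, hA]; ring

/-! ## The structure factor of the ferromagnetic Perron amplitude -/

/-- **`S(k₁)` at `Δ = 1`:** for the Perron amplitude of sector `M` of `H(1)` on `(ℤ/L)²`, `L ≥ 3`:
`strucC a = ((L²/2)² − M²)/(2(L² − 1))` (uniform amplitude ⇒ exchangeability moment). [folklore] -/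
theorem strucC_at_one (hL : 3 ≤ L) {M : ℝ} {a : TensorIndex (TorusSite 2 L) 2 → ℝ}
    (ha : IsPerronSectorGroundAmplitude L 1 M a) :
    strucC L a = ((((L : ℝ) ^ 2 / 2) ^ 2 - M ^ 2)) / (2 * ((L : ℝ) ^ 2 - 1)) := by
  have hL2 : 2 ≤ L := le_trans (by norm_num) hL
  obtain ⟨W, u, hMW, hW, hunif⟩ := Stiffness.Doob.perronAmplitude_at_one_uniform M a ha
  set S := Stiffness.Exch.sector (TorusSite 2 L) W with hS
  set P : ℝ := (S.card : ℝ) with hP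
  set A₀ : ℝ := (Stiffness.Exch.A W (0 : TorusSite 2 L) (0 + Pi.single 0 1) : ℝ) with hA₀
  have hsq : ∀ σ, a σ ^ 2 = if Stiffness.Exch.occ σ = W then u ^ 2 else 0 := by
    intro σ; rw [hunif σ]; split_ifs <;> simp
  -- u² · |S| = 1
  have hnorm : u ^ 2 * P = 1 := by
    rw [← ha.unit]; simp only [hsq]
    rw [← Finset.sum_filter, Finset.sum_const, nsmul_eq_mul, mul_comm]; rfl
  -- strucC = u² Σ_{σ∈S} c(σ)²
  have hstr : strucC L a = u ^ 2 * ∑ σ ∈ S, cosWave L σ ^ 2 := by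
    unfold strucC feynmanVec
    simp only [mul_pow, hsq, mul_ite, mul_zero]
    rw [← Finset.sum_filter, Finset.mul_sum]
    refine Finset.sum_congr rfl fun σ _ => by ring
  -- exchangeability count `V(V−1) A₀ = W (V − W) |S|`
  have hne0 : (0 : TorusSite 2 L) ≠ 0 + Pi.single 0 1 := (Stiffness.add_single_ne_self hL2 0 0).symm
  have hcardT : Fintype.card (TorusSite 2 L) = L ^ 2 := by rw [Fintype.card_fun, ZMod.card, Fintype.card_fin]
  have hAcount : (L : ℝ) ^ 2 * ((L : ℝ) ^ 2 - 1) * A₀ = (W : ℝ) * ((L : ℝ) ^ 2 - W) * P := by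
    have h := Stiffness.Exch.card_card_pred_mul_A (α := TorusSite 2 L) W hne0
    rw [hcardT] at h
    have h' := congrArg (fun n : ℕ => (n : ℝ)) h
    have h1 : 1 ≤ L ^ 2 := Nat.one_le_pow _ _ (by omega)
    push_cast [Nat.cast_sub h1, Nat.cast_sub hW] at h'
    rw [hA₀, hP, hS]
    linear_combination h'
  rw [hstr, sum_sector_cosWave_sq hL2 W, ← hA₀, sum_siteCos_sq hL]
  -- solve for `u² A₀` and substitute `W = L²/2 − M`
  have hV1 : (0 : ℝ) < (L : ℝ) ^ 2 - 1 := by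
    have : (3 : ℝ) ≤ L := by exact_mod_cast hL
    nlinarith
  have hPpos : 0 < P := by
    have : 0 < u ^ 2 * P := by rw [hnorm]; exact one_pos
    rcases lt_trichotomy P 0 with hneg | hzero | hpos
    · exact absurd hneg (not_lt.2 (by rw [hP]; positivity))
    · rw [hzero, mul_zero] at this; exact absurd this (lt_irrefl 0)
    · exact hpos
  have hWM : (W : ℝ) = (L : ℝ) ^ 2 / 2 - M := by linarith [hMW]
  rw [eq_div_iff (by positivity)]
  have key : u ^ 2 * A₀ * ((L : ℝ) ^ 2 * ((L : ℝ) ^ 2 - 1)) = (W : ℝ) * ((L : ℝ) ^ 2 - W) := by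
    calc u ^ 2 * A₀ * ((L : ℝ) ^ 2 * ((L : ℝ) ^ 2 - 1)) = u ^ 2 * ((L : ℝ) ^ 2 * ((L : ℝ) ^ 2 - 1) * A₀) := by ring
      _ = u ^ 2 * ((W : ℝ) * ((L : ℝ) ^ 2 - W) * P) := by rw [hAcount]
      _ = (W : ℝ) * ((L : ℝ) ^ 2 - W) * (u ^ 2 * P) := by ring
      _ = (W : ℝ) * ((L : ℝ) ^ 2 - W) := by rw [hnorm, mul_one]
  have hL0 : (0 : ℝ) < (L : ℝ) ^ 2 := by positivity
  have key2 : u ^ 2 * A₀ * ((L : ℝ) ^ 2 - 1) = (W : ℝ) * ((L : ℝ) ^ 2 - W) / (L : ℝ) ^ 2 := by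
    rw [eq_div_iff hL0.ne']; linear_combination key
  calc u ^ 2 * (A₀ * ((L : ℝ) ^ 2 / 2)) * (2 * ((L : ℝ) ^ 2 - 1))
      = (u ^ 2 * A₀ * ((L : ℝ) ^ 2 - 1)) * (L : ℝ) ^ 2 := by ring
    _ = (W : ℝ) * ((L : ℝ) ^ 2 - W) := by rw [key2, div_mul_cancel₀ _ hL0.ne']
    _ = ((L : ℝ) ^ 2 / 2) ^ 2 - M ^ 2 := by rw [hWM]; ring

/-- **every Temple-form sector gap at `Δ = 1` is `O(1/L²)`:** `SectorGapAtLeast L 1 M g` with a Perron amplitude in the sector and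
`M² < (L²/2)²` forces `g ≤ 4π²(L² − 1)/((L²/2)² − M²)` (FEYNMAN–BIJL `g ≤ fsumC/strucC`, `fsumC ≤ 2π²`, `strucC_at_one`). [folklore] -/
theorem sectorGap_at_one_le (hL : 3 ≤ L) {M g : ℝ} (hG : SectorGapAtLeast L 1 M g)
    {a : TensorIndex (TorusSite 2 L) 2 → ℝ} (ha : IsPerronSectorGroundAmplitude L 1 M a)
    (hM : M ^ 2 < ((L : ℝ) ^ 2 / 2) ^ 2) :
    g ≤ 4 * Real.pi ^ 2 * ((L : ℝ) ^ 2 - 1) / (((L : ℝ) ^ 2 / 2) ^ 2 - M ^ 2) := by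
  have hL2 : 2 ≤ L := le_trans (by norm_num) hL
  have hV1 : (0 : ℝ) < (L : ℝ) ^ 2 - 1 := by
    have : (3 : ℝ) ≤ L := by exact_mod_cast hL
    nlinarith
  have hS : strucC L a = ((((L : ℝ) ^ 2 / 2) ^ 2 - M ^ 2)) / (2 * ((L : ℝ) ^ 2 - 1)) := strucC_at_one hL ha
  have hSpos : 0 < strucC L a := by rw [hS]; exact div_pos (by linarith) (by positivity)
  have h1 := gap_le_feynmanBijl hG ha hL2 hSpos
  have h2 := fsumC_le_two_pi_sq ha hL2
  have h3 : fsumC L 1 M a / strucC L a ≤ 2 * Real.pi ^ 2 / strucC L a := div_le_div_of_nonneg_right h2 hSpos.le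
  have h4 : 2 * Real.pi ^ 2 / strucC L a = 4 * Real.pi ^ 2 * ((L : ℝ) ^ 2 - 1) / (((L : ℝ) ^ 2 / 2) ^ 2 - M ^ 2) := by
    rw [hS, div_div_eq_mul_div]; ring
  linarith [h4 ▸ h3]

/-- **THE DOMAIN EDGE `Δ = 1`:** for every `c > 0` and `k`, for all large EVEN `L` no sector `0 ≤ j ≤ k` of the isotropic ferromagnet
`H(1)` on `(ℤ/L)²` has a Temple-form sector gap `≥ c/L` — the full-gap (R-route) form of (H2) fails at the SU(2) point (the
sector ground states are the uniform states, `S(k₁) ↛ 0`, and Feynman–Bijl caps the gap at `O(1/L²)`).  For odd `L` the integer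
sectors are empty and `SectorGapAtLeast` is vacuous. [folklore] -/
theorem not_sectorGapAtLeast_at_one {c : ℝ} (hc : 0 < c) (k : ℕ) :
    ∀ᶠ L : ℕ in atTop, ∀ [NeZero L], Even L → ∀ j : ℕ, j ≤ k → ¬ SectorGapAtLeast L 1 (j : ℝ) (c / (L : ℝ)) := by
  have hT1 : ∀ᶠ L : ℕ in atTop, 2 * k + 3 ≤ L := Filter.eventually_ge_atTop _
  have hT2 : ∀ᶠ L : ℕ in atTop, 64 * Real.pi ^ 2 / c < (L : ℝ) :=
    tendsto_natCast_atTop_atTop.eventually_gt_atTop _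
  filter_upwards [hT1, hT2] with L hL1 hL2
  intro _ hev j hj hG
  have hL3 : 3 ≤ L := by omega
  have hLr : (3 : ℝ) ≤ L := by exact_mod_cast hL3
  have hLpos : (0 : ℝ) < L := by linarith
  -- a Perron amplitude in the sector `j`
  obtain ⟨a₀, ha₀⟩ := exists_perron_zero_of_even (L := L) (1 : ℝ) hev
  have hjL : 2 * j ≤ L ^ 2 := le_trans (by omega) (le_trans hL1 (Nat.le_self_pow two_ne_zero L))
  obtain ⟨a, ha⟩ := exists_perron_nat ha₀ j hjL
  -- `j² ≤ L⁴/8`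
  have hjk : (j : ℝ) ≤ k := by exact_mod_cast hj
  have hkL : 2 * (k : ℝ) + 3 ≤ L := by exact_mod_cast hL1
  have hj2 : 8 * (j : ℝ) ^ 2 ≤ ((L : ℝ) ^ 2) ^ 2 := by
    have h1 : (j : ℝ) ^ 2 ≤ (L : ℝ) ^ 2 := by
      have hj0 : (0 : ℝ) ≤ j := Nat.cast_nonneg _
      nlinarith
    have h2 : (8 : ℝ) ≤ (L : ℝ) ^ 2 := by nlinarith
    nlinarith
  have hM : ((j : ℕ) : ℝ) ^ 2 < ((L : ℝ) ^ 2 / 2) ^ 2 := by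
    have hL4 : 0 < ((L : ℝ) ^ 2) ^ 2 := by positivity
    nlinarith [hj2, hL4]
  have hgap := sectorGap_at_one_le hL3 hG ha hM
  -- `4π²(L²−1)/((L²/2)² − j²) ≤ 32π²/L² < c/L`
  have hden : ((L : ℝ) ^ 2) ^ 2 / 8 ≤ ((L : ℝ) ^ 2 / 2) ^ 2 - (j : ℝ) ^ 2 := by nlinarith
  have hdenpos : 0 < ((L : ℝ) ^ 2) ^ 2 / 8 := by positivity
  have hub : 4 * Real.pi ^ 2 * ((L : ℝ) ^ 2 - 1) / (((L : ℝ) ^ 2 / 2) ^ 2 - (j : ℝ) ^ 2)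
      ≤ 32 * Real.pi ^ 2 / (L : ℝ) ^ 2 := by
    calc 4 * Real.pi ^ 2 * ((L : ℝ) ^ 2 - 1) / (((L : ℝ) ^ 2 / 2) ^ 2 - (j : ℝ) ^ 2)
        ≤ 4 * Real.pi ^ 2 * (L : ℝ) ^ 2 / (((L : ℝ) ^ 2 / 2) ^ 2 - (j : ℝ) ^ 2) :=
          div_le_div_of_nonneg_right (by nlinarith [Real.pi_pos]) (by linarith)
      _ ≤ 4 * Real.pi ^ 2 * (L : ℝ) ^ 2 / (((L : ℝ) ^ 2) ^ 2 / 8) :=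
          div_le_div_of_nonneg_left (by positivity) hdenpos hden
      _ = 32 * Real.pi ^ 2 / (L : ℝ) ^ 2 := by field_simp; ring
  have hlt : 32 * Real.pi ^ 2 / (L : ℝ) ^ 2 < c / (L : ℝ) := by
    rw [div_lt_div_iff₀ (by positivity) hLpos]
    have h1 : 64 * Real.pi ^ 2 < c * L := by
      have := hL2; rw [div_lt_iff₀ hc] at this; linarith
    nlinarith [h1, hLpos]
  linarith

end Summit.HubbardSuperconductivity.HubbardSuperconductivity.Theorems.AnisotropyChord.Transfer
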